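import Literature.MathematicalPhysics.QuantumLattice.HubbardHubbardModelPairDecayProofs
import Mathlib.Order.LiminfLimsup
import HarnessLib
import HarnessLib.Audit

/-!
# Hubbard ladder — Bounds: the Koma–Tasaki exponent and the `η = 1/4` line
# (bounds.tex Thm 10 / Cor 10.1; the UNCONDITIONAL side of the `T_c` table)

HONEST FRAMING (cell pub-hubbard): ladder R1–R4 with certified numbers; no claim on H/H₀. These
are bounds for a MODEL CLASS — here the grand-canonical repulsive-or-attractive Hubbard model
`hubbardTorusWith 2 L t U μ` on the square torus `(ℤ/Lℤ)²` (every `L ≥ 1`, every real `t, U, μ`,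
every `β > 0`); no materials claim. Companion text: `pub-hubbard/paper/bounds.tex` §Theorem 10;
tables `pub-hubbard/pub-hubbard-bounds/BOUNDS.md` (row T8) and `EXTREMISERS.md` §5c.

## Content

Everything in bounds.tex above Theorem 10 that mentions a critical temperature is CONDITIONAL
(hypothesis NK_q, the Nelson–Kosterlitz stiffness jump). Theorem 10 is the one unconditional
statement of the table: the McBryan–Spencer / Koma–Tasaki complex-gauge bound makes the thermal
pair correlation `G_{β,L}(x,y) = ⟨c†_{x↑} c†_{x↓} c_{y↓} c_{y↑}⟩_{β,L}` decay at least as a power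
`dist(x,y)^{-η_b(T)}` with an EXPLICIT exponent growing linearly in `T/|t|`, uniformly in `L`,
`U` and `μ`. Reading (Cor 10.1): wherever `η_b(T) > 1/4`, algebraic pair order of
Kosterlitz–Thouless type with the Nelson–Kosterlitz exponent `η ≤ 1/4` is excluded — for every
`U` and every filling.

* `norm_pairCorr_le_rpow_explicit` — **machine-checked, explicit**: for `0 < q ≤ 1` with
  `f_q := 2q - 128 β|t| q² ≥ 0`, every torus `L ≥ 1` and all sites,
  `|G_{β,L}(x,y)| ≤ (dist(x,y) + 1)^{-f_q}`. (The tree's `koma_tasaki_2d_holds` fixes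
  `q = 1/(1 + 128β|t|)` and hides the exponent behind `∃ f > 0`; here `q` is free, which is what
  the `η`-line needs. Ingredients: the tree's a-priori gauge bound `norm_thermalCorr_pair_le_exp`
  and test potential `exists_torusTestPotential`, energy constant `128`.)
* `PairEtaLineTorus` / `pairEtaLineTorus_holds` — **machine-checked `η`-line (torus, uniform)**:
  `β|t| < 1/32` (i.e. `T > 32|t|`) ⟹ `∃ f > 1/4`, `|G_{β,L}(x,y)| ≤ (dist + 1)^{-f}` for every
  `L`, `x`, `y` (and every `U`, `μ`). Honest number: the threshold `32|t|` is the tree's constants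
  (`128` in the test-potential energy, and a factor `2` in the a-priori bound's hopping
  perturbation norm); it is NOT the sharp value.
* `PairEtaLineSharp` — **TYPED ONLY (statement; proof = bounds.tex Thm 10, NOT machine-checked)**:
  the sharp McBryan–Spencer exponent of the nearest-neighbour class in the thermodynamic limit is
  `η_b(T) = T/(π|t|)` (harmonic dipole potential, lattice potential-kernel asymptotics
  `a(z) = (2/π) log|z| + k + o(1)`, Lawler 1991 Thm 1.6.2), so the `η = 1/4` line sits at
  `T_{1/4} = π|t|/4 ≈ 0.785|t|` (Koma–Tasaki's footnote constant `α = (2πt)⁻¹` is conservative by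
  a factor `2`; with next-nearest-neighbour hopping `t'` the line is `(π/4)(|t| + 2|t'|)`). The
  `def` records the exact statement the paper proves, in the torus-`limsup` form; no `_holds`.

References (keys of `lean/references.bib`): KomaTasakiPRL1992 (Theorem, eqs. (4)–(13), note 9);
McBryanSpencer1977; FriedliVelenikSMLS2017 Thm 9.12; LawlerLimic2010 §4.4 (and G. F. Lawler,
*Intersections of Random Walks* (1991) Thm 1.6.2 — no bib key); NelsonKosterlitz1977;
HazraVermaRanderia2019 §III (the conditional side this complements). bounds.tex Thm 10 also
proves `f(β) = 1/β` exactly at every `β` (quartic remainder along the harmonic dipole) and the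
optimality of `η_b(T) = T/(π(|t|+2|t'|))` within the method (Dirichlet principle).
-/

noncomputable section

namespace Summit.HubbardSuperconductivity.HubbardLadder.Bounds

open Matrix Finset NormedSpace
open Literature.MathematicalPhysics.QuantumLattice Literature.Probability.LatticeModels
open scoped Matrix.Norms.L2Operator ComplexOrder

/-! ### The explicit torus bound with a free gauge charge `q` -/

/-- **Koma–Tasaki with the exponent exposed.** For the Hubbard model on `(ℤ/Lℤ)²`, all real
`t, U, μ`, `β > 0`, every `0 < q ≤ 1` with `f_q = 2q - 128 β|t| q² ≥ 0`, and all sites `x, y`: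
`|⟨c†_{x↑} c†_{x↓} c_{y↓} c_{y↑}⟩_{β,L}| ≤ (dist(x,y) + 1)^{-f_q}`, uniformly in `L`.
Proof = the tree's `koma_tasaki_2d_holds` with `q` kept free: a-priori bound
`norm_thermalCorr_pair_le_exp` + test potential `exists_torusTestPotential` + `H(D) ≥ log(D+1)`.
Koma–Tasaki, PRL 68 (1992) 3248, eqs. (5)–(12). -/
theorem norm_pairCorr_le_rpow_explicit (L : ℕ) [NeZero L] (t U μ β q : ℝ) (hβ : 0 < β)
    (hq0 : 0 < q) (hq1 : q ≤ 1) (hf : 0 ≤ 2 * q - 128 * (β * |t|) * q ^ 2)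
    (x y : TorusSite 2 L) :
    ‖(hubbardTorusWith 2 L t U μ).thermalCorr β (onSitePair x)ᴴ (onSitePair y)‖ ≤
      ((torusDist x y : ℝ) + 1) ^ (-(2 * q - 128 * (β * |t|) * q ^ 2)) := by
  set B : ℝ := 128 * (β * |t|) with hB
  set f : ℝ := 2 * q - B * q ^ 2 with hfdef
  have hf0 : 0 ≤ f := hf
  -- the test potential on `(ℤ/Lℤ)²`, pulled back to the fermionic torus
  obtain ⟨ψ, hψy, hψx, hE⟩ := exists_torusTestPotential L x y hq0.le hq1
  have key := norm_thermalCorr_pair_le_exp (fermionTorusGraph 2 L) t U μ hβ.le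
    (fun u => ψ (FermionTorus.toTorusSite u)) (FermionTorus.ofTorusSite x)
    (FermionTorus.ofTorusSite y)
  have hsumeq : (∑ u : FermionTorus 2 L, ∑ v : FermionTorus 2 L,
      if (fermionTorusGraph 2 L).Adj u v then
        2 * (Real.cosh (ψ (FermionTorus.toTorusSite u) - ψ (FermionTorus.toTorusSite v)) - 1)
      else 0) =
      ∑ a : TorusSite 2 L, ∑ b : TorusSite 2 L,
        if (torusGraph 2 L).Adj a b then 2 * (Real.cosh (ψ a - ψ b) - 1) else 0 := by
    refine Fintype.sum_equiv FermionTorus.equivTorusSite _ _ fun u => ?_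
    refine Fintype.sum_equiv FermionTorus.equivTorusSite _ _ fun v => ?_
    simp [FermionTorus.equivTorusSite]
  simp only [FermionTorus.toTorusSite_ofTorusSite, hψy, hψx, sub_zero] at key
  rw [hsumeq] at key
  have hrw : (hubbardTorusWith 2 L t U μ).thermalCorr β (onSitePair x)ᴴ (onSitePair y) =
      (hamiltonianWith (fermionTorusGraph 2 L) t U μ).thermalCorr β
        (creation (orb (FermionTorus.ofTorusSite x) 0) *
          creation (orb (FermionTorus.ofTorusSite x) 1))
        (annihilation (orb (FermionTorus.ofTorusSite y) 1) *
          annihilation (orb (FermionTorus.ofTorusSite y) 0)) := by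
    rw [onSitePair_conjTranspose]
    rfl
  rw [hrw]
  refine Eq.trans_le ?_ (key.trans ?_)
  · congr!
  -- arithmetic: `exp(-2qH_D) exp(β|t|E) ≤ exp(-f H_D) ≤ (D+1)^{-f}`
  set D : ℕ := torusDist x y with hD
  have hHD : Real.log ((D : ℝ) + 1) ≤ (harmonic D : ℝ) := by
    have := log_add_one_le_harmonic D
    push_cast at this
    exact this
  have hβt : 0 ≤ β * |t| := by positivity
  have hE' : β * (|t| * ∑ a : TorusSite 2 L, ∑ b : TorusSite 2 L,
      (if (torusGraph 2 L).Adj a b then 2 * (Real.cosh (ψ a - ψ b) - 1) else 0)) ≤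
      B * q ^ 2 * (harmonic D : ℝ) := by
    calc β * (|t| * ∑ a : TorusSite 2 L, ∑ b : TorusSite 2 L,
          (if (torusGraph 2 L).Adj a b then 2 * (Real.cosh (ψ a - ψ b) - 1) else 0))
        = (β * |t|) * ∑ a : TorusSite 2 L, ∑ b : TorusSite 2 L,
          (if (torusGraph 2 L).Adj a b then 2 * (Real.cosh (ψ a - ψ b) - 1) else 0) := by
          ring
      _ ≤ (β * |t|) * (128 * q ^ 2 * (harmonic D : ℝ)) := mul_le_mul_of_nonneg_left hE hβt
      _ = B * q ^ 2 * (harmonic D : ℝ) := by rw [hB]; ring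
  have hDpos : (0 : ℝ) < (D : ℝ) + 1 := by positivity
  calc Real.exp (-2 * (q * (harmonic D : ℝ))) *
        Real.exp (β * (|t| * ∑ a : TorusSite 2 L, ∑ b : TorusSite 2 L,
          (if (torusGraph 2 L).Adj a b then 2 * (Real.cosh (ψ a - ψ b) - 1) else 0)))
      ≤ Real.exp (-2 * (q * (harmonic D : ℝ))) * Real.exp (B * q ^ 2 * (harmonic D : ℝ)) := by
        gcongr
    _ = Real.exp (-(f * (harmonic D : ℝ))) := by
        rw [← Real.exp_add, hfdef]
        congr 1
        ring
    _ ≤ Real.exp (-(f * Real.log ((D : ℝ) + 1))) := by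
        gcongr
    _ = (((torusDist x y : ℕ) : ℝ) + 1) ^ (-f) := by
        rw [← hD, Real.rpow_def_of_pos hDpos]
        congr 1
        ring

/-! ### The machine-checked `η`-line on the torus -/

/-- **Cor 10.2 (torus form, tree constants; PROVED below).** For the Hubbard model on
`(ℤ/Lℤ)²` with any real `t, U, μ`: if `β|t| < 1/32` (temperature `T > 32|t|`) there is an
exponent `f > 1/4` with `|⟨c†_{x↑} c†_{x↓} c_{y↓} c_{y↑}⟩_{β,L}| ≤ (dist(x,y)+1)^{-f}` for EVERY
`L ≥ 1` and all `x, y` — pair correlations decay uniformly faster than the Nelson–Kosterlitz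
borderline `r^{-1/4}`, so no KT pair quasi-condensate (η ≤ 1/4) exists there, whatever `U`, `μ`.
kind: support (PROVED). Why it might fail: it cannot; the threshold `32|t|` is loose by a factor
`≈ 40` against the sharp `π|t|/4` of `PairEtaLineSharp` (tree constants `128` and `2`).
Sources: KomaTasakiPRL1992 Theorem + note 9; NelsonKosterlitz1977; this cell bounds.tex Thm 10. -/
@[conjecture] def PairEtaLineTorus : Prop :=
  ∀ (t U μ β : ℝ), 0 < β → β * |t| < 1 / 32 →
    ∃ f : ℝ, 1 / 4 < f ∧ ∀ (L : ℕ) [NeZero L] (x y : TorusSite 2 L),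
      ‖(hubbardTorusWith 2 L t U μ).thermalCorr β (onSitePair x)ᴴ (onSitePair y)‖ ≤
        ((torusDist x y : ℝ) + 1) ^ (-f)

/-- **`PairEtaLineTorus` holds.** With `B = 128β|t| < 4`: if `B ≤ 1` take `q = 1`
(`f = 2 - B ≥ 1`), else `q = 1/B` (`f = 1/B > 1/4`). -/
theorem pairEtaLineTorus_holds : PairEtaLineTorus := by
  intro t U μ β hβ hβt
  set B : ℝ := 128 * (β * |t|) with hB
  have hB0 : 0 ≤ B := by positivity
  have hB4 : B < 4 := by rw [hB]; linarith
  by_cases hB1 : B ≤ 1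
  · -- `q = 1`
    refine ⟨2 * 1 - 128 * (β * |t|) * 1 ^ 2, by rw [← hB]; linarith, ?_⟩
    intro L _ x y
    exact norm_pairCorr_le_rpow_explicit L t U μ β 1 hβ one_pos le_rfl
      (by rw [← hB]; linarith) x y
  · -- `q = 1/B`
    rw [not_le] at hB1
    have hBpos : 0 < B := by linarith
    have hq0 : 0 < 1 / B := by positivity
    have hq1 : 1 / B ≤ 1 := by rw [div_le_one hBpos]; exact hB1.le
    have hfval : 2 * (1 / B) - 128 * (β * |t|) * (1 / B) ^ 2 = 1 / B := by
      rw [← hB]; field_simp; ring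
    refine ⟨2 * (1 / B) - 128 * (β * |t|) * (1 / B) ^ 2, ?_, ?_⟩
    · rw [hfval, one_div, one_div]
      exact (inv_lt_inv₀ (by norm_num) hBpos).2 hB4
    · intro L _ x y
      exact norm_pairCorr_le_rpow_explicit L t U μ β (1 / B) hβ hq0 hq1
        (by rw [hfval]; positivity) x y

/-! ### The sharp statement (typed only) -/

/-- The site of `(ℤ/Lℤ)²` under a lattice vector `z ∈ ℤ²` (reduction mod `L`). -/
def torusSiteOfInt (L : ℕ) (z : Fin 2 → ℤ) : TorusSite 2 L := fun i => ((z i : ℤ) : ZMod L)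

/-- The Euclidean length `|z|` of `z ∈ ℤ²`. -/
def intNorm (z : Fin 2 → ℤ) : ℝ := Real.sqrt (((z 0 : ℤ) : ℝ) ^ 2 + ((z 1 : ℤ) : ℝ) ^ 2)

/-- **Thm 10 / Cor 10.2, sharp form (TYPED ONLY — proof in bounds.tex §Thm 10, NOT
machine-checked; no `_holds`).** Nearest-neighbour Hubbard model on `(ℤ/Lℤ)²`, any real
`t, U, μ`, `β > 0`. The thermodynamic-limit decay exponent of the pair correlation is at least
the McBryan–Spencer value `η_b(T) = T/(π|t|)`: for every `ε > 0` there is `R` such that for all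
`z ∈ ℤ²` with `|z| ≥ R`,
`limsup_{L→∞} |⟨c†_{0↑} c†_{0↓} c_{z↓} c_{z↑}⟩_{β,L}| ≤ |z|^{-(1-ε)/(π β |t|)}`.
Hence (the `η = 1/4` line) for `T > π|t|/4 ≈ 0.785|t|` the pair correlations decay faster than
`|z|^{-1/4-δ}` for some `δ > 0`: no KT pair quasi-order with `η ≤ 1/4`, for every `U` and filling.
Proof inputs beyond the tree: the harmonic dipole test potential (lattice Green's function) in
place of `exists_torusTestPotential`, the sharp hopping-perturbation norm
`‖c†_u c_v + c†_v c_u‖ = 1` (a factor 2 below the tree's `norm_hoppingPerturbation_le`), and the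
potential-kernel asymptotics `a(z) = (2/π) log|z| + k + o(1)` (Lawler 1991, Thm 1.6.2).
At `t = 0` the exponent is the junk value `0` (bound `1`, true). kind: support (TYPED; paper
proof). Why it might fail: a slip in the paper's constant bookkeeping (the factor-2 claims against
KomaTasakiPRL1992 note 9 are the thing a referee should check); the STATEMENT with `(1-ε)/(2πβ|t|)`
is Koma–Tasaki's own. Sources: KomaTasakiPRL1992 Theorem, eqs. (11)–(13), note 9;
McBryanSpencer1977; FriedliVelenik2017 Thm 9.12; Lawler1991 Thm 1.6.2. -/
@[conjecture] def PairEtaLineSharp : Prop :=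
  ∀ (t U μ β : ℝ), 0 < β → ∀ ε : ℝ, 0 < ε →
    ∃ R : ℝ, ∀ z : Fin 2 → ℤ, R ≤ intNorm z →
      Filter.limsup (fun L : ℕ =>
          ‖(hubbardTorusWith 2 (L + 1) t U μ).thermalCorr β
              (onSitePair (torusSiteOfInt (L + 1) 0))ᴴ (onSitePair (torusSiteOfInt (L + 1) z))‖)
        Filter.atTop ≤
        intNorm z ^ (-((1 - ε) / (Real.pi * β * |t|)))

end Summit.HubbardSuperconductivity.HubbardLadder.Bounds

end
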